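/-
Copyright (c) 2026 the pub-hodgecm-mathlib formalisation cell (harness21).  Prover seat hodgecm-mathlib-K2E1-p10 (g6), Track B ∕ K2-LIT, h413 =
`stmt-HodgeConjecture-24833`, route `HCCMUnconditional`; R90-TF S8 «ContSpec-n½», (M) socket road, RES-INT line 7 (7d)-prep: the dictionary letter (D1) of
★ `oneN_at_of_dictionary` ∕ `oneS_at_of_dictionary` DISCHARGED generically — constituents of `P′^∞` seen inside the ambient smooth vectors are constituents of `P′.finRep^∞|_{G_v}`.
-/
import Literature.NumberTheory.Automorphic.IrreducibleClassesComap              -- ★ `IrrClass.comap`, `IrrClass.isConstituentOf_comp_iff_comap_symm`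
import Literature.NumberTheory.Automorphic.IrreducibleClassesConstituents       -- ★ `IrrClass.IsConstituentOf.of_injective`
import Literature.NumberTheory.Automorphic.AdmissibleSubquotient                -- ★ `Representation.stabilizerSubgroup_le_stabilizerSubgroup_map`, smooth-vector calculus
import Literature.NumberTheory.Automorphic.ParabolicInductionAdmissibleProofs   -- ★ `Representation.IsSmooth.comp`
import Literature.NumberTheory.Automorphic.DiscreteAutomorphicRepFinSmoothVector   -- ★ `DiscreteAutomorphicRep.finRep`, `inclPlace`, `continuous_inclPlace`, `localPiEquiv`, `rightRegular` (the §3 frame)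
import HarnessLib

/-!
# R90 · S8 «ContSpec-n½» — `R90S8SmoothPartSubrepConstituentTransferU3`: (D1) DISCHARGED — the smooth vectors of a subrepresentation `σ ↪ R` along `f : G_f → G(𝔸)` are the
# `σ`-vectors smooth in `R ∘ f`; so every constituent of a `G_v`-subrepresentation `P` of the ambient smooth part `(R ∘ f)^∞|_{G_v}` lying inside `σ` is a constituent of
# `σ ∘ f)^∞|_{G_v}` [BernsteinZelevinsky1976 §2.1; BushnellHenniart2006 §§1–2; BorelJacquet1979 §4.6]

Cell `pub/hodgecm-mathlib`, crux H413 = `stmt-HodgeConjecture-24833` (lane `--kind proof --supports stmt-HodgeConjecture-24833 --as helper`), route of record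
`HCCMUnconditional`; programme R90-TF, section S8, the (M) socket road, RES-INT line 7.  THEOREMS ONLY (no `def`, no `instance`, no `notation`, no `sorry`); generic representation
theory (no measure, no adeles).  CLOSES NO SOCKET.

THE USE (★ p865166 `oneN_at_of_dictionary`, 📤 p865229 `oneS_at_of_dictionary`, letter (D1)).  `R :=` the right regular representation of `G(𝔸)` on `V = L²(G(F)\G(𝔸))` (as a bare
`Representation`), `σ := P′.space.toContRep.toRepresentation` with `j` the inclusion (injective intertwining), `f := finAdelicToAdelic` (so `σ ∘ f = P′.finRep`), `i := inclPlace v :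
↥(localPi v) →* G(𝔸_f)`, `e := localPiEquiv v : ↥(localPi v) ≃ₜ* G_v`.  The ambient `G_v`-module of (D1) is `ρ_v := ((R ∘ f)^∞ ∘ i) ∘ e⁻¹` on `X := ↥(R ∘ f)^∞` (smooth: §2
`isSmooth_smoothPart_comp_comp_symm`), `P := P′^∞` = the vectors of `(R ∘ f)^∞` lying in `P′.space = range j`; (D1) asks that every constituent `c` of `P` give a constituent `comap e c` of
`P′.finRep^∞ ∘ i = (σ ∘ f)^∞ ∘ i` — §2 `isConstituentOf_comap_smoothPart_comp_of_le_range`.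
THE MATHEMATICS.  For an INJECTIVE intertwining map `j : σ → R` the stabilisers agree: `Stab_σ(w) = Stab_R(j w)` (§1 `stabilizerSubgroup_eq_of_injective`), so `w` is smooth iff `j w` is
(`isSmoothVector_iff_of_injective`); the same along `f` (`j` intertwines `σ ∘ f` and `R ∘ f`).  Hence `x ↦ j⁻¹ x` is an injective `G_v`-map from `P` (vectors of `(R ∘ f)^∞` in `range j`,
as a subrepresentation of `(R ∘ f)^∞ ∘ i`) into `(σ ∘ f)^∞ ∘ i`; constituents pass along injective maps (★ `IsConstituentOf.of_injective`) and through `e` (★ `isConstituentOf_comp_iff_comap_symm`).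
* §1 `stabilizerSubgroup_eq_of_injective` · `isSmoothVector_iff_of_injective`.
* §2 `isSmooth_smoothPart_comp_comp_symm` ((D1)'s `hρv`) · **`isConstituentOf_comap_smoothPart_comp_of_le_range`** ((D1)'s `hD1`).
* §3 the adelic frame of ★ `LocalConstituentsIn`: `isSmooth_rightRegular_fin_smoothPart_comp_inclPlace`, **`DiscreteAutomorphicRep.comap_isConstituentOf_finRep_smoothPart_of_forall_mem_space`**
  — (D1) of ★ `oneN_at_of_dictionary` ∕ `oneS_at_of_dictionary` DISCHARGED for the ambient «smooth vectors of `L²`» (the CM frame `quasiSplit L⁺ L c̄ 3 = adelicGroupData … J₃` is an instance by `rfl`).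
HONEST LABEL: HC_CM is proved only modulo the 7 printed citations (2 remaining named inputs: hLiu418 = `stmt-HodgeConjecture-24832`, h413 = `stmt-HodgeConjecture-24833`) until
rung 0 closes; generic, pays no socket; count-neutral.

## References
* [BernsteinZelevinsky1976] I. N. Bernstein, A. V. Zelevinsky, *Representations of the group GL(n,F) where F is a non-archimedean local field*, Russian Math. Surveys 31:3 (1976), §2.1.
* [BushnellHenniart2006] C. J. Bushnell, G. Henniart, *The Local Langlands Conjecture for GL(2)* (2006), §1.1–§2.
* [BorelJacquet1979] A. Borel, H. Jacquet, *Automorphic forms and automorphic representations*, Proc. Sympos. Pure Math. 33.1 (1979), §4.6.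
-/

set_option autoImplicit false
-- the mandated namespace repeats the single-problem summit's segment (`HodgeConjecture.HodgeConjecture`)
set_option linter.dupNamespace false

noncomputable section

open MeasureTheory NumberField IsDedekindDomain
open Literature.NumberTheory.Automorphic Literature.NumberTheory.Automorphic.UnitaryGroup Literature.RepresentationTheory.FiniteGroups

namespace Summit.HodgeConjecture.HodgeConjecture.R90.S8

/-! ## §1 Smooth vectors along an injective intertwining map -/

section Injective

variable {k : Type*} [CommRing k] {H : Type*} [Group H] {V W : Type*} [AddCommGroup V] [Module k V] [AddCommGroup W] [Module k W]
  {R : Representation k H V} {σ : Representation k H W}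

/-- **Stabilisers agree along an injective intertwining map**: `Stab_σ(w) = Stab_R(j w)` (`≤` is ★ `stabilizerSubgroup_le_stabilizerSubgroup_map`; `≥` uses injectivity:
`j (h·w) = h·(j w) = j w`). [cite: BernsteinZelevinsky1976, §2.1] -/
theorem stabilizerSubgroup_eq_of_injective (j : σ.IntertwiningMap R) (hj : Function.Injective j) (w : W) :
    σ.stabilizerSubgroup w = R.stabilizerSubgroup (j w) := by
  refine le_antisymm (Representation.stabilizerSubgroup_le_stabilizerSubgroup_map j w) fun h hh => ?_
  rw [Representation.mem_stabilizerSubgroup] at hh ⊢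
  apply hj
  rw [j.isIntertwining, hh]

/-- **Smoothness is detected along an injective intertwining map**: `w` is a smooth vector of `σ` iff `j w` is a smooth vector of `R`. [cite: BernsteinZelevinsky1976, §2.1] -/
theorem isSmoothVector_iff_of_injective [TopologicalSpace H] (j : σ.IntertwiningMap R) (hj : Function.Injective j) (w : W) :
    σ.IsSmoothVector w ↔ R.IsSmoothVector (j w) := by
  unfold Representation.IsSmoothVector
  rw [stabilizerSubgroup_eq_of_injective j hj w]

end Injective

/-! ## §2 (D1): constituents of `P ≤ (R ∘ f)^∞|_{G_v}` inside `range j` are constituents of `(σ ∘ f)^∞|_{G_v}` -/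

section Transfer

universe u

variable {Gbig : Type*} [Group Gbig] {Gfin : Type*} [Group Gfin] [TopologicalSpace Gfin] [SeparatelyContinuousMul Gfin]
  {Gπ G : Type u} [Group Gπ] [TopologicalSpace Gπ] [Group G] [TopologicalSpace G]
  {V W : Type} [AddCommGroup V] [Module ℂ V] [AddCommGroup W] [Module ℂ W]
  {R : Representation ℂ Gbig V} {σ : Representation ℂ Gbig W}

/-- **THE AMBIENT `G_v`-MODULE IS SMOOTH** ((D1)'s `hρv`): `((R ∘ f)^∞ ∘ i) ∘ e⁻¹` is a smooth representation of `G_v` for `i` continuous (★ `isSmooth_smoothPart` ∘ ★ `IsSmooth.comp` twice).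
[cite: BernsteinZelevinsky1976, §2.1] -/
theorem isSmooth_smoothPart_comp_comp_symm (f : Gfin →* Gbig) (i : Gπ →* Gfin) (hi : Continuous i) (e : Gπ ≃ₜ* G) :
    Representation.IsSmooth ((((Representation.smoothPart (R.comp f)).toRepresentation).comp i).comp (e.symm : G →* Gπ)) :=
  ((Representation.isSmooth_smoothPart (R.comp f)).comp i hi).comp (e.symm : G →* Gπ) e.symm.continuous

/-- **(D1) DISCHARGED — CONSTITUENTS OF `P′^∞` INSIDE THE AMBIENT SMOOTH PART ARE CONSTITUENTS OF `P′.finRep^∞|_{G_v}`.**  Let `j : σ → R` be an injective intertwining map of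
`G(𝔸)`-representations (`V, W : Type`), `f : G_f →* G(𝔸)`, `i : G_π →* G_f`, `e : G_π ≃ₜ* G_v`, and `P` a `G_v`-subrepresentation of `((R ∘ f)^∞ ∘ i) ∘ e⁻¹` whose vectors lie in `range j`.
Then every constituent class `c` of `P` gives the constituent `comap e c` of `(σ ∘ f)^∞ ∘ i`: read `P` as a subrepresentation of `(R ∘ f)^∞ ∘ i` (so `c ↦ comap e c`, ★
`isConstituentOf_comp_iff_comap_symm`), and map it injectively and `G_π`-equivariantly into `(σ ∘ f)^∞` by `x ↦ j⁻¹ x` — smooth in `σ ∘ f` because `j` detects smoothness (§1) — then ★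
`IsConstituentOf.of_injective`. [cite: BernsteinZelevinsky1976, §2.1] [cite: BushnellHenniart2006, §2] [cite: BorelJacquet1979, §4.6] -/
theorem isConstituentOf_comap_smoothPart_comp_of_le_range (j : σ.IntertwiningMap R) (hj : Function.Injective j) (f : Gfin →* Gbig) (i : Gπ →* Gfin) (e : Gπ ≃ₜ* G)
    (P : Subrepresentation ((((Representation.smoothPart (R.comp f)).toRepresentation).comp i).comp (e.symm : G →* Gπ)))
    (hP : ∀ x ∈ P, ((x : ↥(Representation.smoothPart (R.comp f)).toSubmodule) : V) ∈ LinearMap.range j.toLinearMap)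
    {c : IrrClass G} (hc : c.IsConstituentOf P.toRepresentation) :
    (IrrClass.comap e c).IsConstituentOf (((Representation.smoothPart (σ.comp f)).toRepresentation).comp i) := by
  -- `P` as a subrepresentation `Pπ` of `ρπ := (R ∘ f)^∞ ∘ i`; `P.toRepresentation` IS `Pπ.toRepresentation ∘ e⁻¹`
  have hstab : ∀ (g : Gπ) (x : ↥(Representation.smoothPart (R.comp f)).toSubmodule), x ∈ P.toSubmodule →
      (((Representation.smoothPart (R.comp f)).toRepresentation).comp i) g x ∈ P.toSubmodule := fun g x hx => by
    have h := P.apply_mem_toSubmodule (e g) hx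
    change (((Representation.smoothPart (R.comp f)).toRepresentation).comp i) (e.symm (e g)) x ∈ P.toSubmodule at h
    rwa [ContinuousMulEquiv.symm_apply_apply] at h
  set Pπ : Subrepresentation (((Representation.smoothPart (R.comp f)).toRepresentation).comp i) := ⟨P.toSubmodule, fun g _ hx => hstab g _ hx⟩ with hPπ
  have hc' : c.IsConstituentOf (Pπ.toRepresentation.comp (e.symm : G →* Gπ)) := hc
  have hc2 : (IrrClass.comap e c).IsConstituentOf Pπ.toRepresentation := by
    have h2 := (IrrClass.isConstituentOf_comp_iff_comap_symm e.symm Pπ.toRepresentation c).1 hc'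
    rwa [ContinuousMulEquiv.symm_symm] at h2
  -- `j` read along `f`: an injective intertwining map `σ ∘ f → R ∘ f`
  set jf : Representation.IntertwiningMap (σ.comp f) (R.comp f) := ⟨j.toLinearMap, fun g => j.isIntertwining' (f g)⟩ with hjf
  have hjf_apply : ∀ w : W, jf w = j w := fun w => rfl
  have hjf_inj : Function.Injective jf := hj
  -- the inverse dictionary `x ↦ j⁻¹ x` on `Pπ`
  set jr : W ≃ₗ[ℂ] LinearMap.range j.toLinearMap := LinearEquiv.ofInjective j.toLinearMap hj with hjr
  have hjr_symm : ∀ y : LinearMap.range j.toLinearMap, j (jr.symm y) = (y : V) := fun y => by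
    have h := congrArg Subtype.val (jr.apply_symm_apply y)
    rwa [hjr, LinearEquiv.ofInjective_apply] at h
  set t : ↥Pπ.toSubmodule →ₗ[ℂ] V := (Representation.smoothPart (R.comp f)).toSubmodule.subtype ∘ₗ Pπ.toSubmodule.subtype with ht
  set tr : ↥Pπ.toSubmodule →ₗ[ℂ] LinearMap.range j.toLinearMap := LinearMap.codRestrict (LinearMap.range j.toLinearMap) t fun x => hP x.1 x.2 with htr
  set w₀ : ↥Pπ.toSubmodule →ₗ[ℂ] W := jr.symm.toLinearMap ∘ₗ tr with hw₀def
  have hw₀ : ∀ x : ↥Pπ.toSubmodule, j (w₀ x) = ((x : ↥(Representation.smoothPart (R.comp f)).toSubmodule) : V) := fun x => hjr_symm (tr x)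
  -- its values are smooth in `σ ∘ f` (smoothness detected by `jf`)
  have hsm : ∀ x : ↥Pπ.toSubmodule, w₀ x ∈ (Representation.smoothPart (σ.comp f)).toSubmodule := fun x => by
    change Representation.IsSmoothVector (σ.comp f) (w₀ x)
    rw [isSmoothVector_iff_of_injective jf hjf_inj, hjf_apply, hw₀]
    exact (x : ↥(Representation.smoothPart (R.comp f)).toSubmodule).2
  set u₀ : ↥Pπ.toSubmodule →ₗ[ℂ] ↥(Representation.smoothPart (σ.comp f)).toSubmodule := LinearMap.codRestrict _ w₀ hsm with hu₀def
  have hu₀ : ∀ x : ↥Pπ.toSubmodule, ((u₀ x : ↥(Representation.smoothPart (σ.comp f)).toSubmodule) : W) = w₀ x := fun x => rfl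
  -- `G_π`-equivariance and injectivity: both checked after `j` (injective)
  have hequiv : ∀ (g : Gπ) (x : ↥Pπ.toSubmodule),
      u₀ (Pπ.toRepresentation g x) = (((Representation.smoothPart (σ.comp f)).toRepresentation).comp i) g (u₀ x) := fun g x => by
    apply Subtype.ext
    apply hj
    simp only [hu₀, hw₀, Subrepresentation.toRepresentation_apply_coe, MonoidHom.coe_comp, Function.comp_apply,
      Representation.IntertwiningMap.isIntertwining]
  have hinj : Function.Injective u₀ := fun x y hxy => by
    apply Subtype.ext
    apply Subtype.ext
    have h := congrArg (fun z : ↥(Representation.smoothPart (σ.comp f)).toSubmodule => j (z : W)) hxy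
    simp only [hu₀, hw₀] at h
    exact h
  set u : Pπ.toRepresentation.IntertwiningMap (((Representation.smoothPart (σ.comp f)).toRepresentation).comp i) :=
    ⟨u₀, fun g => LinearMap.ext (hequiv g)⟩ with hu
  exact hc2.of_injective u hinj

end Transfer

/-! ## §3 The adelic frame: `R = ` the right regular representation on `L²`, `σ = P.space`, `f = finAdelicToAdelic`, `i = inclPlace v`, `e = localPiEquiv v` -/

section Adelic

variable {F E : Type} [Field F] [NumberField F] [Field E] [NumberField E] [Algebra F E] {c : E ≃ₐ[F] E} {N : ℕ} {J : Matrix (Fin N) (Fin N) E}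
  {μ : Measure (adelicGroupData F E c N J).automorphicQuotient} [(adelicGroupData F E c N J).IsAutomorphicMeasure μ]

/-- **THE AMBIENT `U(J)(F_v)`-MODULE OF THE DICTIONARY IS SMOOTH**: the smooth vectors of `L²(U(J)(F)\U(J)(𝔸_F))` for the finite-adelic right translation, restricted to the place `v`
along ★ `inclPlace v` and read on ★ `«local» E c N J v` through ★ `localPiEquiv v` — (D1)'s `hρv` in ★ `oneN_at_of_dictionary` ∕ `oneS_at_of_dictionary`. [cite: BernsteinZelevinsky1976, §2.1] [cite: BorelJacquet1979, §4.6] -/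
theorem isSmooth_rightRegular_fin_smoothPart_comp_inclPlace (v : HeightOneSpectrum (𝓞 F)) :
    Representation.IsSmooth ((((Representation.smoothPart (((adelicGroupData F E c N J).rightRegular μ).toRepresentation.comp (finAdelicToAdelic F E c N J))).toRepresentation).comp
      (inclPlace F E c N J v)).comp ((localPiEquiv E c N J v).symm : «local» E c N J v →* ↥(localPi E c N J v))) :=
  isSmooth_smoothPart_comp_comp_symm (finAdelicToAdelic F E c N J) (inclPlace F E c N J v) (continuous_inclPlace F E c N J v) (localPiEquiv E c N J v)

/-- **(D1) IN THE ADELIC FRAME — CONSTITUENTS OF `P^∞` READ INSIDE THE SMOOTH VECTORS OF `L²` ARE LOCAL CONSTITUENTS OF `P`.**  For a discrete automorphic `P` and a `U(J)(F_v)`-subrepresentation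
`Q` of the ambient smooth `L²`-vectors (restricted to `v`, read on `«local» v`) all of whose vectors lie in `P.space`: every constituent class `c₀` of `Q` gives the local constituent
`comap (localPiEquiv v) c₀` of `P.finRep.smoothPart ∘ inclPlace v` (the currency of ★ `LocalConstituentsIn` and of (M) :299's letters) — §2 at the injective inclusion `P.space ↪ L²`
(`P.finRep = P.space ∘ finAdelicToAdelic` is `rfl`). [cite: BorelJacquet1979, §4.6] [cite: BushnellHenniart2006, §2] [cite: BernsteinZelevinsky1976, §2.1] -/
theorem _root_.Literature.NumberTheory.Automorphic.DiscreteAutomorphicRep.comap_isConstituentOf_finRep_smoothPart_of_forall_mem_space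
    (P : DiscreteAutomorphicRep (adelicGroupData F E c N J) μ) (v : HeightOneSpectrum (𝓞 F))
    (Q : Subrepresentation ((((Representation.smoothPart (((adelicGroupData F E c N J).rightRegular μ).toRepresentation.comp (finAdelicToAdelic F E c N J))).toRepresentation).comp
      (inclPlace F E c N J v)).comp ((localPiEquiv E c N J v).symm : «local» E c N J v →* ↥(localPi E c N J v))))
    (hQ : ∀ x ∈ Q, ((x : ↥(Representation.smoothPart (((adelicGroupData F E c N J).rightRegular μ).toRepresentation.comp (finAdelicToAdelic F E c N J))).toSubmodule) :
      (adelicGroupData F E c N J).L2 μ) ∈ P.space.toSubmodule)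
    {c₀ : IrrClass («local» E c N J v)} (hc₀ : c₀.IsConstituentOf Q.toRepresentation) :
    (IrrClass.comap (localPiEquiv E c N J v) c₀).IsConstituentOf (P.finRep.smoothPart.toRepresentation.comp (inclPlace F E c N J v)) := by
  -- the inclusion `P.space ↪ L²` as an injective intertwining map into the right regular representation
  set jP : Representation.IntertwiningMap P.space.toContRep.toRepresentation ((adelicGroupData F E c N J).rightRegular μ).toRepresentation :=
    ⟨P.space.toSubmodule.subtype, fun g => LinearMap.ext fun x => rfl⟩ with hjP
  have hjP_inj : Function.Injective jP := Subtype.val_injective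
  have hrange : ∀ x ∈ Q, ((x : ↥(Representation.smoothPart (((adelicGroupData F E c N J).rightRegular μ).toRepresentation.comp (finAdelicToAdelic F E c N J))).toSubmodule) :
      (adelicGroupData F E c N J).L2 μ) ∈ LinearMap.range jP.toLinearMap := fun x hx => by
    rw [show jP.toLinearMap = P.space.toSubmodule.subtype from rfl, Submodule.range_subtype]
    exact hQ x hx
  exact isConstituentOf_comap_smoothPart_comp_of_le_range jP hjP_inj (finAdelicToAdelic F E c N J) (inclPlace F E c N J v) (localPiEquiv E c N J v) Q hrange hc₀

end Adelic

end Summit.HodgeConjecture.HodgeConjecture.R90.S8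

end
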